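import Mathlib
import HarnessLib
import Summits.HubbardSuperconductivity.HubbardSuperconductivity.Theorems.KLProgrammeKLRegimeEnginePairTransferPlainIncrementBooking
import Summits.HubbardSuperconductivity.HubbardSuperconductivity.Theorems.KLProgrammeKLRegimeEnginePairTransferMemberDefectDiffRows

/-!
# Route `KLProgramme` — ENGINE item stmt-HubbardSuperconductivity-20437 `KLRegimeEngineV17F2`, stub (c) value lane, «(c)-OUT» brick (M2) (pen (R211)(2) GO):
# THE OUT-OF-CLASS STEP DOOR IN ROWS FORM — the un-resummed slice increment of the member pair array bounded by the FIVE CLASS ROWS of the Riccati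
# defect (`klmd_defect_le_rows`: ≥ 2 cross lines `RH`, member ph direct `RP` / crossed `RQ`, born overlap `RS`, frequency localisation `RL`) + the pp slot
# (cell gate-hubbard-kl, seat hubbard-kl-k3c2-p2 g18; door map HOME/hubbard-kl-k3c2-p2/OUT-OF-CLASS-E2.md §1–§3)

`klmf_memberArray_increment_le_source_add_ppGain` (…PlainIncrementBooking, p641557) gives, out of the pair class at `n+1`,
`‖A 1 x y − A 0 x y‖ ≤ ∫₀¹‖S_t(x,y)‖ + (Klam U)²·klEngGeo11.ppGain (n+1) |p_Qm|_𝕋` with `S = Ȧ + A·diag ḃ·A`; k3c1-p1's ξᵢ door `klmd_defect_le_rows` (…MemberDefectDiffRows)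
bounds `‖S_t(x,y)‖` by `(Λₙ − Λₙ₊₁)·(½RH + (βL²)⁻³(RP + RQ + 2RS)) + RL` from the five rows at `(t,x,y)`.  Here the two are composed for the family member
`ψ = s^K_{n+1,j}` (`n+1 ≤ j`; `j = n+1` is the PLAIN amplitude, `ψ = 0`) with `t`-UNIFORM row constants at the fixed external pair `(x,y)`:
* `integral_le_of_forall_le_Icc` — `∫₀¹ f ≤ C` from `0 ≤ f ≤ C` on `[0,1]` (no integrability needed: a non-integrable `f` integrates to `0 ≤ C`);
* **`outClass_increment_le_rows`** — binders = the regime/package binders of p641557 + the literal objects of `klmd_defect_le_rows` at `ψ := s_{n+1,j}` (`A Ȧ ḃ V V6 Σ Hd Φ ẇ Br`,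
  pass `rfl`) + the five rows `∀ t ∈ [0,1]` with constants `RH RP RQ RS RL`; conclusion
  `‖A 1 x y − A 0 x y‖ ≤ (Λₙ − Λₙ₊₁)·(½RH + (βL²)⁻³(RP + RQ + 2RS)) + RL + (Klam U)²·klEngGeo11.ppGain (n+1) |p_Qm|_𝕋`.
What books where (OUT-OF-CLASS-E2.md §2/§5, pen (R211)): `RP/RQ` above the leg-transfer threshold → `…MemberPHTailPhGain.Wd/Wx_member_row_le_phGain_klEngGeo11` (phGain's two-shell
branch, p641998); `RP/RQ` below threshold → the SIGNED rows `klms_memberPH_direct/crossed_signed_le` keyed on the kernel-flatness data `(ε, L_A)` of the located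
«(c)-OUT-PH-FLAT» (supplier «(E4)-DRESSED-MOMENTS», post-FREEZE); `RS` → born row; `RH`, `RL` → k3c1-p1's Hd/LOC rows; pp ✓ here.  (M3) = that arithmetic.
Composition only (one `klmd_defect_le_rows` call per `t`); nothing about the model's sizes is asserted; nothing asserts (E2″-F), (c), K3 or superconductivity.  0 kit · 0 lit.
-/

noncomputable section

namespace Summit.HubbardSuperconductivity.HubbardSuperconductivity.Theorems.KLRegimeSplit

set_option linter.dupNamespace false -- summit = problem name (single-conjunct summit), D-0017

open Finset Matrix Set Literature.MathematicalPhysics.QuantumLattice Literature.Probability.LatticeModels GrassmannAlgebra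
open Summit.HubbardSuperconductivity.HubbardSuperconductivity.Theorems.KLProgrammeLegKernels
open Summit.HubbardSuperconductivity.HubbardSuperconductivity.Theorems.TwoPointAssembly
open Summit.HubbardSuperconductivity.HubbardSuperconductivity.Theorems.DispersionFlow
open Summit.HubbardSuperconductivity.HubbardSuperconductivity.Theorems.KLRegimeWick
open Summit.HubbardSuperconductivity.HubbardSuperconductivity.Theorems.EngineV8

/-- `∫₀¹ f ≤ C` when `0 ≤ f ≤ C` on `[0,1]` — integrable or not (a non-integrable `f` has interval integral `0`, and `C ≥ f 0 ≥ 0`). -/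
theorem integral_le_of_forall_le_Icc {f : ℝ → ℝ} {C : ℝ} (h0 : ∀ t ∈ Icc (0 : ℝ) 1, 0 ≤ f t) (h : ∀ t ∈ Icc (0 : ℝ) 1, f t ≤ C) :
    (∫ t in (0 : ℝ)..1, f t) ≤ C := by
  have hC : 0 ≤ C := (h0 0 ⟨le_rfl, zero_le_one⟩).trans (h 0 ⟨le_rfl, zero_le_one⟩)
  by_cases hf : IntervalIntegrable f MeasureTheory.volume 0 1
  · have hmono := intervalIntegral.integral_mono_on zero_le_one hf (intervalIntegrable_const (c := C)) fun t ht => h t ht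
    simpa using hmono
  · rw [intervalIntegral.integral_undef hf]; exact hC

variable (L M : ℕ) [NeZero L] [NeZero M] (β U μ : ℝ) (K : TrigPolyC4v) {R : RenConsts} {N : ℕ}

/-- **THE OUT-OF-CLASS STEP DOOR, ROWS FORM** (module docstring). -/
theorem outClass_increment_le_rows (hR : R.WF2) (hU : 0 < U) (hUu : U ≤ klTSU R) (hμ : μ ∈ klWindowC)
    (hK : FrameOK R U N μ K) (hβ : klBetaMin ≤ β) (hβL : β ≤ L) {n j : ℕ} (hn : n ≤ nScales β) (hj : n + 1 ≤ j)
    (hGL : 8 * (4 + 8 / 3 * R.Gfr 1 * U ^ 2) * β ≤ L) {Qm : TorusSite 2 L} (hQ : ¬ IsPairClassAt L Qm (n + 1))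
    (hZ : ∀ Λ ∈ Icc (klScale klE0 (n + 1)) (klScale klE0 n), hubbardEffPartitionFnCT L M β U μ 0 K Λ ≠ 0)
    (A A' : ℝ → Matrix (TorusSite 2 L) (TorusSite 2 L) ℂ) (b' : ℝ → TorusSite 2 L → ℂ)
    (hAdef : A = fun t => Matrix.of fun k k' : TorusSite 2 L => if k ∈ klBall L μ 0 ∧ k' ∈ klBall L μ 0 then
      vertexFn L M β (gaussConv ℂ (softCovOf L M β μ K (softSymbolCompl L M β μ K (n + 1) j) + hubbardCovAboveCT L M β μ 0 K (klScale klE0 (n + 1)) - hubbardCovAboveCT L M β μ 0 K (klScale klE0 n + t * (klScale klE0 (n +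
              1) - klScale klE0 n))) (hubbardEffectiveActionCT L M β U μ 0 K (klScale klE0 n + t * (klScale klE0 (n + 1) - klScale klE0 n)))) 4 ![(((omega0 M, k'), 0), 0), ((((omega0
              M).rev, Qm - k'), 1), 0), ((((omega0 M).rev, Qm - k), 1), 1), (((omega0 M, k), 0), 1)]
      else 0)
    (hA'def : A' = fun t => Matrix.of fun k k' : TorusSite 2 L => if k ∈ klBall L μ 0 ∧ k' ∈ klBall L μ 0 then
      (klScale klE0 (n + 1) - klScale klE0 n) • -((2 : ℂ)⁻¹ * vertexFn L M β (gaussConv ℂ (softCovOf L M β μ K (softSymbolCompl L M β μ K (n + 1) j) + hubbardCovAboveCT L M β μ 0 K (klScale klE0 (n + 1)) -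
              hubbardCovAboveCT L M β μ 0 K (klScale klE0 n + t * (klScale klE0 (n + 1) - klScale klE0 n))) (grassmannDerivPairing ℂ (Matrix.of fun X Y : HubbardFieldIdx L M => deriv
              (fun Λ'' : ℝ => hubbardCovAboveCT L M β μ 0 K Λ'' X Y) (klScale klE0 n + t * (klScale klE0 (n + 1) - klScale klE0 n))) (hubbardEffectiveActionCT L M β U μ 0 K (klScale
              klE0 n + t * (klScale klE0 (n + 1) - klScale klE0 n))) (hubbardEffectiveActionCT L M β U μ 0 K (klScale klE0 n + t * (klScale klE0 (n + 1) - klScale klE0 n))))) 4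
              ![(((omega0 M, k'), 0), 0), ((((omega0 M).rev, Qm - k'), 1), 0), ((((omega0 M).rev, Qm - k), 1), 1), (((omega0 M, k), 0), 1)])
      else 0)
    (hb'def : b' = fun (t : ℝ) (p : TorusSite 2 L) => (((klScale klE0 (n + 1) - klScale klE0 n) *
        (klBubbleMass L M β μ K (fun k => deriv (fun Λ' => hubbardCutoffWeightCT L M β μ K Λ' k) (klScale klE0 n + t * (klScale klE0 (n + 1) - klScale klE0 n))) (fun k => (softSymbolCompl L M β μ K (n + 1) j) k +
                (hubbardCutoffWeightCT L M β μ K (klScale klE0 (n + 1)) k - hubbardCutoffWeightCT L M β μ K (klScale klE0 n + t * (klScale klE0 (n + 1) - klScale klE0 n)) k)) Qm p +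
          klBubbleMass L M β μ K (fun k => (softSymbolCompl L M β μ K (n + 1) j) k + (hubbardCutoffWeightCT L M β μ K (klScale klE0 (n + 1)) k - hubbardCutoffWeightCT L M β μ K (klScale klE0 n + t * (klScale klE0 (n + 1)
                  - klScale klE0 n)) k)) (fun k => deriv (fun Λ' => hubbardCutoffWeightCT L M β μ K Λ' k) (klScale klE0 n + t * (klScale klE0 (n + 1) - klScale klE0 n))) Qm p) : ℝ) :
                  ℂ))
    (V : ℝ → (Fin 4 → HubbardFieldIdx L M) → ℂ) (hV : V = fun t X => vertexFn L M β (gaussConv ℂ (softCovOf L M β μ K (softSymbolCompl L M β μ K (n + 1) j) + hubbardCovAboveCT L M β μ 0 K (klScale klE0 (n + 1)) -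
            hubbardCovAboveCT L M β μ 0 K (klScale klE0 n + t * (klScale klE0 (n + 1) - klScale klE0 n))) (hubbardEffectiveActionCT L M β U μ 0 K (klScale klE0 n + t * (klScale klE0 (n
            + 1) - klScale klE0 n)))) 4 X)
    (V6 : ℝ → (Fin 6 → HubbardFieldIdx L M) → ℂ) (hV6 : V6 = fun t X => vertexFn L M β (gaussConv ℂ (softCovOf L M β μ K (softSymbolCompl L M β μ K (n + 1) j) + hubbardCovAboveCT L M β μ 0 K (klScale klE0 (n + 1)) -
            hubbardCovAboveCT L M β μ 0 K (klScale klE0 n + t * (klScale klE0 (n + 1) - klScale klE0 n))) (hubbardEffectiveActionCT L M β U μ 0 K (klScale klE0 n + t * (klScale klE0 (n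
            + 1) - klScale klE0 n)))) 6 X)
    (Sg : ℝ → FreqMomentum L M → Fin 2 → ℂ) (hSg : Sg = fun t p σ => selfEnergy L M β (gaussConv ℂ (softCovOf L M β μ K (softSymbolCompl L M β μ K (n + 1) j) + hubbardCovAboveCT L M β μ 0 K (klScale klE0 (n + 1)) -
            hubbardCovAboveCT L M β μ 0 K (klScale klE0 n + t * (klScale klE0 (n + 1) - klScale klE0 n))) (hubbardEffectiveActionCT L M β U μ 0 K (klScale klE0 n + t * (klScale klE0 (n
            + 1) - klScale klE0 n)))) p σ)
    (Hd : ℝ → (Fin 4 → HubbardFieldIdx L M) → ℂ) (hHd : Hd = fun t X => vertexFn L M β (dblFold ℂ (grassmannLaplacian ℂ (crossCov ℂ (Matrix.of fun X Y : HubbardFieldIdx L M => deriv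
            (fun Λ' : ℝ => hubbardCovAboveCT L M β μ 0 K Λ' X Y) (klScale klE0 n + t * (klScale klE0 (n + 1) - klScale klE0 n)))) ((gaussConv ℂ (crossCov ℂ (softCovOf L M β μ K (softSymbolCompl L M β μ K (n + 1) j) +
            hubbardCovAboveCT L M β μ 0 K (klScale klE0 (n + 1)) - hubbardCovAboveCT L M β μ 0 K (klScale klE0 n + t * (klScale klE0 (n + 1) - klScale klE0 n)))) - grassmannLaplacian ℂ
            (crossCov ℂ (softCovOf L M β μ K (softSymbolCompl L M β μ K (n + 1) j) + hubbardCovAboveCT L M β μ 0 K (klScale klE0 (n + 1)) - hubbardCovAboveCT L M β μ 0 K (klScale klE0 n + t * (klScale klE0 (n + 1) -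
            klScale klE0 n))))) (dblCopy ℂ 0 (gaussConv ℂ (softCovOf L M β μ K (softSymbolCompl L M β μ K (n + 1) j) + hubbardCovAboveCT L M β μ 0 K (klScale klE0 (n + 1)) - hubbardCovAboveCT L M β μ 0 K (klScale klE0 n
            + t * (klScale klE0 (n + 1) - klScale klE0 n))) (hubbardEffectiveActionCT L M β U μ 0 K (klScale klE0 n + t * (klScale klE0 (n + 1) - klScale klE0 n)))) * dblCopy ℂ 1
            (gaussConv ℂ (softCovOf L M β μ K (softSymbolCompl L M β μ K (n + 1) j) + hubbardCovAboveCT L M β μ 0 K (klScale klE0 (n + 1)) - hubbardCovAboveCT L M β μ 0 K (klScale klE0 n + t * (klScale klE0 (n + 1) -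
            klScale klE0 n))) (hubbardEffectiveActionCT L M β U μ 0 K (klScale klE0 n + t * (klScale klE0 (n + 1) - klScale klE0 n)))))))) 4 X)
    (Φ : ℝ → FreqMomentum L M → ℝ) (hΦ : Φ = fun t k => (softSymbolCompl L M β μ K (n + 1) j) k + (hubbardCutoffWeightCT L M β μ K (klScale klE0 (n + 1)) k - hubbardCutoffWeightCT L M β μ K (klScale klE0 n + t * (klScale
            klE0 (n + 1) - klScale klE0 n)) k))
    (Wd : ℝ → FreqMomentum L M → ℝ) (hWd : Wd = fun t k => deriv (fun Λ' : ℝ => hubbardCutoffWeightCT L M β μ K Λ' k) (klScale klE0 n + t * (klScale klE0 (n + 1) - klScale klE0 n)))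
    (Br : ℝ → TorusSite 2 L × MatsubaraIdx M → ℂ) (hBr : Br = fun t z => -(((((β * (L : ℝ) ^ 2 : ℝ) : ℂ)))⁻¹ * propCT L M β μ K (z.2, z.1) * propCT L M β μ K (z.2.rev, Qm - z.1)) *
      ((((klScale klE0 (n + 1) - klScale klE0 n) * (-Wd t (z.2, z.1) * Φ t (z.2.rev, Qm - z.1) - Φ t (z.2, z.1) * Wd t (z.2.rev, Qm - z.1))) : ℝ) : ℂ))
    {P : SplitConsts} {m : ℝ} (hm0 : 0 ≤ m) (hm : m ^ 2 ≤ 2 ^ 8 * (P.Klam * U) ^ 2) (hAm : ∀ t ∈ Icc (0 : ℝ) 1, ∀ x y, ‖A t x y‖ ≤ m)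
    (x y : TorusSite 2 L) {RH RP RQ RS RL : ℝ}
    (hRH : ∀ t ∈ Icc (0 : ℝ) 1, ‖Hd t ![(((omega0 M, y), 0), 0), ((((omega0 M).rev, Qm - y), 1), 0), ((((omega0 M).rev, Qm - x), 1), 1), (((omega0 M, x), 0), 1)]‖ ≤ RH)
    (hRP : ∀ t ∈ Icc (0 : ℝ) 1, ‖(∑ p : FreqMomentum L M, ∑ σ : Fin 2, ∑ p' : FreqMomentum L M,
            if matsubaraInt M p'.1 + matsubaraInt M (omega0 M) = matsubaraInt M p.1 + matsubaraInt M (omega0 M) ∧ p'.2 = p.2 + x - y then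
              ((((((Φ t p) : ℝ) : ℂ) * (((β * (L : ℝ) ^ 2 : ℝ) : ℂ) * propCT L M β μ K p)) * ((((Wd t p') : ℝ) : ℂ) * (((β * (L : ℝ) ^ 2 : ℝ) : ℂ) * propCT L M β μ K p'))) + (((((Wd t
                      p) : ℝ) : ℂ) * (((β * (L : ℝ) ^ 2 : ℝ) : ℂ) * propCT L M β μ K p)) * ((((Φ t p') : ℝ) : ℂ) * (((β * (L : ℝ) ^ 2 : ℝ) : ℂ) * propCT L M β μ K p')))) *
                (V t ![((p, σ), 1), ((p', σ), 0), (((omega0 M, y), 0), 0), (((omega0 M, x), 0), 1)] *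
                  V t ![((p, σ), 0), ((p', σ), 1), ((((omega0 M).rev, Qm - y), 1), 0), ((((omega0 M).rev, Qm - x), 1), 1)])
            else 0)‖ ≤ RP)
    (hRQ : ∀ t ∈ Icc (0 : ℝ) 1, ‖(∑ p : FreqMomentum L M, ∑ p' : FreqMomentum L M,
            if matsubaraInt M p'.1 + matsubaraInt M (omega0 M) + matsubaraInt M (omega0 M) + 1 = matsubaraInt M p.1 ∧ p'.2 = p.2 + Qm - x - y then
              ((((((Φ t p) : ℝ) : ℂ) * (((β * (L : ℝ) ^ 2 : ℝ) : ℂ) * propCT L M β μ K p)) * ((((Wd t p') : ℝ) : ℂ) * (((β * (L : ℝ) ^ 2 : ℝ) : ℂ) * propCT L M β μ K p'))) + (((((Wd t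
                      p) : ℝ) : ℂ) * (((β * (L : ℝ) ^ 2 : ℝ) : ℂ) * propCT L M β μ K p)) * ((((Φ t p') : ℝ) : ℂ) * (((β * (L : ℝ) ^ 2 : ℝ) : ℂ) * propCT L M β μ K p')))) *
                (V t ![((p, 0), 1), ((p', 1), 0), (((omega0 M, y), 0), 0), ((((omega0 M).rev, Qm - x), 1), 1)] *
                  V t ![((p, 0), 0), ((p', 1), 1), ((((omega0 M).rev, Qm - y), 1), 0), (((omega0 M, x), 0), 1)])
            else 0)‖ ≤ RQ)
    (hRS : ∀ t ∈ Icc (0 : ℝ) 1, ‖(∑ p : FreqMomentum L M, ∑ σ : Fin 2,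
            (((((Wd t p) : ℝ) : ℂ) * (((β * (L : ℝ) ^ 2 : ℝ) : ℂ) * propCT L M β μ K p)) * ((((Φ t p) : ℝ) : ℂ) * (((β * (L : ℝ) ^ 2 : ℝ) : ℂ) * propCT L M β μ K p))) *
              (V6 t ![((p, σ), 0), ((p, σ), 1), (((omega0 M, y), 0), 0), ((((omega0 M).rev, Qm - y), 1), 0), ((((omega0 M).rev, Qm - x), 1), 1),
                (((omega0 M, x), 0), 1)] *
                Sg t p σ))‖ ≤ RS)
    (hRL : ∀ t ∈ Icc (0 : ℝ) 1, ‖∑ z : TorusSite 2 L × MatsubaraIdx M, Br t z *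
          ((if z.1 ∈ klBall L μ 0 then
              V t ![(((omega0 M, z.1), 0), 0), ((((omega0 M).rev, Qm - z.1), 1), 0), ((((omega0 M).rev, Qm - x), 1), 1), (((omega0 M, x), 0), 1)] *
                V t ![(((omega0 M, y), 0), 0), ((((omega0 M).rev, Qm - y), 1), 0), ((((omega0 M).rev, Qm - z.1), 1), 1), (((omega0 M, z.1), 0), 1)]
            else 0) -
            V t ![(((z.2, z.1), 0), 0), (((z.2.rev, Qm - z.1), 1), 0), ((((omega0 M).rev, Qm - x), 1), 1), (((omega0 M, x), 0), 1)] *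
              V t ![(((omega0 M, y), 0), 0), ((((omega0 M).rev, Qm - y), 1), 0), (((z.2.rev, Qm - z.1), 1), 1), (((z.2, z.1), 0), 1)])‖ ≤ RL) :
    ‖A 1 x y - A 0 x y‖ ≤
      (klScale klE0 n - klScale klE0 (n + 1)) * (2⁻¹ * RH + ((β * (L : ℝ) ^ 2) ^ 3)⁻¹ * (RP + RQ + 2 * RS)) + RL +
        (P.Klam * U) ^ 2 * klEngGeo11.ppGain (n + 1) (klTorusNorm L Qm) := by
  have hβ0 : 0 < β := pos_of_klBetaMin_le hβ
  have hψ : ∀ k : FreqMomentum L M, (softSymbolCompl L M β μ K (n + 1) j) (k.1.rev, k.2) = (softSymbolCompl L M β μ K (n + 1) j) k :=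
    (isSoftSymbol_compl (L := L) (M := M) β μ K hj).2
  -- the rows door, pointwise in `t`
  have hpt : ∀ t ∈ Icc (0 : ℝ) 1, ‖(A' t + A t * diagonal (b' t) * A t) x y‖ ≤
      (klScale klE0 n - klScale klE0 (n + 1)) * (2⁻¹ * RH + ((β * (L : ℝ) ^ 2) ^ 3)⁻¹ * (RP + RQ + 2 * RS)) + RL := fun t ht =>
    klmd_defect_le_rows L M β U μ K hβ0 n hψ Qm A A' b' hAdef hA'def hb'def V hV V6 hV6 Sg hSg Hd hHd Φ hΦ Wd hWd Br hBr ht x y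
      (hRH t ht) (hRP t ht) (hRQ t ht) (hRS t ht) (hRL t ht)
  have hint : (∫ t in (0 : ℝ)..1, ‖(fun s => A' s + A s * diagonal (b' s) * A s) t x y‖) ≤
      (klScale klE0 n - klScale klE0 (n + 1)) * (2⁻¹ * RH + ((β * (L : ℝ) ^ 2) ^ 3)⁻¹ * (RP + RQ + 2 * RS)) + RL :=
    integral_le_of_forall_le_Icc (fun t _ => norm_nonneg _) fun t ht => hpt t ht
  have hinc := klmf_memberArray_increment_le_source_add_ppGain L M β U μ K hR hU hUu hμ hK hβ hβL hn hj hGL hQ hZ A A' hAdef hA'def b' hb'def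
    (fun s => A' s + A s * diagonal (b' s) * A s) (fun s _ => rfl) hm0 hm hAm x y
  linarith

end Summit.HubbardSuperconductivity.HubbardSuperconductivity.Theorems.KLRegimeSplit

end
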